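import Summits.Schanuel.Schanuel.Theorems.ZilberEacQuadraticLogRelations
import Summits.Schanuel.Schanuel.Theorems.ZilberEacReciprocalOrders
import Mathlib.Analysis.Calculus.MeanValue
import Mathlib.Analysis.Calculus.Deriv.Inv
import HarnessLib

/-!
# The equimodular class, XXXIV: the logarithm of a branch of a RECIPROCAL-TYPE quadratic fibre is
# transcendental over `ℂ(z)`

HONEST FRAMING.  Cell `pub-schanuel` (Zilber's Exponential-Algebraic Closedness, case ladder;
host summit Schanuel), seat 2, gen 24.  **`not_algebraic_log_quadraticBranch`**: let
`q₁, q₂ ∈ ℂ[z]`, `c ∈ ℂ`, `D = q₁² - 4c q₂²`, `W = q₁q₂' - q₂q₁'`; suppose `q₂` has a root `a` with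
`q₁(a) ≠ 0` and `D` has a root of odd multiplicity (e.g. a simple root; `D` is then not a square).  If `S, L` are analytic at `z₀` with `S² = D` and
`L' = W S/(q₂ D)` near `z₀` (`(q₂D)(z₀) ≠ 0`) — e.g. `L = log(ρ/θ)` for a branch
`ρ = (-q₁ + S)/(2q₂)` of `q₂y² + q₁y + c q₂ = 0` — then NO nonzero `H ∈ ℂ[s][t]` has `H(z, L z) = 0`
near `z₀`.  Proof: the trace identity of file XXXIII gives `(p_{M-1}/p_M)' = -M L'` near a generic
point `z₁`, so `L = κ + (U₁ + V₁ S)/V₂` with explicit polynomials; comparing derivatives (`S' = D'/(2S)`)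
yields `2q₂D(U₁'V₂ - U₁V₂') = Γ₁·S` with `Γ₁ = 2WV₂² - q₂(2D(V₁'V₂ - V₁V₂') + D'V₁V₂) ≠ 0` (file XXXI,
orders at `a`), whence `D·Γ₁² = (2q₂D(U₁'V₂ - U₁V₂'))²` as polynomials — impossible at a simple root
of `D` (file XXXI).  This is the valuation-free substitute, for QUADRATIC algebraic functions, of
"the logarithm of a non-constant algebraic function is transcendental"; it removes the hypothesis
`q_0 ≠ c·q_r` of THEOREM EB for `y₀`-degree `2` (file XXXV).  [folklore, made concrete]; nothing
here is specific to Schanuel's conjecture (neither used nor implied); Mantova–Masser's question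
(PLMS 2024 §1 p. 5) and EC(3,2) stay OPEN.
-/

noncomputable section

open Filter Topology Polynomial Metric

set_option linter.dupNamespace false

namespace Summit.Schanuel.Schanuel.Theorems

/-! ## Part A. Small tools -/

/-- A polynomial vanishing near a point of `ℂ` is zero. [folklore] -/
theorem Polynomial.eq_zero_of_eventually_eval_eq_zero {z₀ : ℂ} {p : ℂ[X]}
    (h : ∀ᶠ z in 𝓝 z₀, p.eval z = 0) : p = 0 := by
  obtain ⟨r, hr, hball⟩ := Metric.eventually_nhds_iff.1 h
  refine Polynomial.eq_zero_of_infinite_isRoot p ?_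
  have hinf : Set.Infinite ((fun t : ℝ => z₀ + (t : ℂ)) '' Set.Ioo 0 r) :=
    (Set.Ioo_infinite hr).image fun t _ s _ hts => by
      simpa using hts
  refine hinf.mono ?_
  rintro _ ⟨t, ht, rfl⟩
  refine hball ?_
  rw [dist_eq_norm, add_sub_cancel_left, Complex.norm_real, Real.norm_eq_abs, abs_of_pos ht.1]
  exact ht.2

/-- Two polynomials agreeing near a point of `ℂ` are equal. [folklore] -/
theorem Polynomial.eq_of_eventually_eval_eq {z₀ : ℂ} {p q : ℂ[X]}
    (h : ∀ᶠ z in 𝓝 z₀, p.eval z = q.eval z) : p = q := by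
  have h0 : ∀ᶠ z in 𝓝 z₀, (p - q).eval z = 0 := by
    filter_upwards [h] with z hz; rw [eval_sub, hz, sub_self]
  exact sub_eq_zero.1 (Polynomial.eq_zero_of_eventually_eval_eq_zero h0)

/-- A function with zero derivative on a ball is constant there. [folklore] -/
theorem eq_of_hasDerivAt_zero_ball {ψ : ℂ → ℂ} {c : ℂ} {r : ℝ}
    (h : ∀ z ∈ ball c r, HasDerivAt ψ 0 z) {z : ℂ} (hz : z ∈ ball c r) (hc : c ∈ ball c r) :
    ψ z = ψ c := by
  have hdiff : DifferentiableOn ℂ ψ (ball c r) := fun w hw => (h w hw).differentiableAt.differentiableWithinAt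
  refine (convex_ball c r).is_const_of_fderivWithin_eq_zero hdiff (fun w hw => ?_) hz hc
  rw [fderivWithin_of_isOpen Metric.isOpen_ball hw, (h w hw).hasFDerivAt.fderiv]
  ext
  simp

/-- **`D·P₁² ≠ P₂²` when `D` has a root of ODD multiplicity** (in particular `D` is not a square).
[folklore] -/
theorem sq_mul_ne_sq_of_odd_rootMultiplicity {D P₁ P₂ : ℂ[X]} {e : ℂ}
    (hodd : Odd (Polynomial.rootMultiplicity e D)) (hP₁ : P₁ ≠ 0) : D * P₁ ^ 2 ≠ P₂ ^ 2 := by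
  have hD0 : D ≠ 0 := by
    intro h; rw [h, Polynomial.rootMultiplicity_zero] at hodd; exact (Nat.not_odd_zero hodd).elim
  intro h
  have hL : rootMultiplicity e (D * P₁ ^ 2) = rootMultiplicity e D + 2 * rootMultiplicity e P₁ := by
    rw [rootMultiplicity_mul (mul_ne_zero hD0 (pow_ne_zero _ hP₁)), pow_two,
      rootMultiplicity_mul (mul_ne_zero hP₁ hP₁)]
    ring
  have hP₂ : P₂ ≠ 0 := by
    intro h2; rw [h2, zero_pow two_ne_zero] at h
    exact (mul_ne_zero hD0 (pow_ne_zero _ hP₁)) h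
  have hR : rootMultiplicity e (P₂ ^ 2) = 2 * rootMultiplicity e P₂ := by
    rw [pow_two, rootMultiplicity_mul (mul_ne_zero hP₂ hP₂)]; ring
  have h2 := congrArg (rootMultiplicity e) h
  rw [hL, hR] at h2
  obtain ⟨k, hk⟩ := hodd
  omega

/-- A simple root has (odd) multiplicity one. [folklore] -/
theorem odd_rootMultiplicity_of_simple_root {D : ℂ[X]} {e : ℂ} (hDe : D.IsRoot e)
    (hD'e : ¬ (derivative D).IsRoot e) : Odd (Polynomial.rootMultiplicity e D) := by
  have hD0 : D ≠ 0 := by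
    intro h; rw [h, derivative_zero] at hD'e; exact hD'e (IsRoot.def.2 (eval_zero))
  have h1 : 1 ≤ rootMultiplicity e D := (rootMultiplicity_pos hD0).2 hDe
  have h2 := derivative_rootMultiplicity_of_root hDe
  have h3 : rootMultiplicity e (derivative D) = 0 := rootMultiplicity_eq_zero hD'e
  have : rootMultiplicity e D = 1 := by omega
  rw [this]; exact odd_one

/-- The key pointwise identity behind the comparison of derivatives (pure field algebra).
[folklore] -/
theorem quadraticLog_key_identity {K : Type*} [Field K] {Q d Nu w V₁ V₂ s Nv D₁ u' ℓ v' v S' : K}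
    (h6 : V₂ ^ 2 * u' = Nu) (h3 : ℓ = u' + v' * s + v * S') (h2 : Q * d * ℓ = w * s)
    (h7 : V₂ ^ 2 * v' = Nv) (h5 : V₂ * v = V₁) (h4 : s ^ 2 = d) (h1 : 2 * s * S' = D₁) :
    2 * Q * d * Nu = s * (2 * w * V₂ ^ 2 - Q * (2 * d * Nv + D₁ * V₁ * V₂)) := by
  linear_combination (-2 * Q * d) * h6 + (-2 * Q * d * V₂ ^ 2) * h3 + (2 * V₂ ^ 2) * h2 +
    (-2 * Q * d * s) * h7 + (-2 * Q * d * V₂ * S') * h5 + (2 * Q * V₁ * V₂ * S') * h4 +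
    (-Q * V₁ * V₂ * s) * h1

/-! ## Part B. The transcendence theorem -/

/-- **The logarithm of a branch of a reciprocal-type quadratic fibre is transcendental over `ℂ(z)`.**
See the module docstring. [folklore, made concrete] (new in this form) -/
theorem not_algebraic_log_quadraticBranch {z₀ : ℂ} (q₁ q₂ D W : ℂ[X]) (c : ℂ)
    (hD : D = q₁ ^ 2 - C (4 * c) * q₂ ^ 2) (hW : W = q₁ * derivative q₂ - q₂ * derivative q₁)
    {a e : ℂ} (hq₂ : q₂ ≠ 0) (ha : q₂.IsRoot a) (hq₁a : ¬ q₁.IsRoot a)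
    (hDodd : Odd (Polynomial.rootMultiplicity e D))
    {S L : ℂ → ℂ} (hSan : AnalyticAt ℂ S z₀) (hLan : AnalyticAt ℂ L z₀)
    (hS2 : ∀ᶠ z in 𝓝 z₀, S z ^ 2 = D.eval z) (hE0 : (q₂ * D).eval z₀ ≠ 0)
    (hL : ∀ᶠ z in 𝓝 z₀, HasDerivAt L (W.eval z * S z / (q₂.eval z * D.eval z)) z)
    {H : ℂ[X][X]} (hH0 : H ≠ 0) (hH : germEval₂ z₀ (AGerm.mk z₀ hLan) H = 0) : False := by
  classical
  obtain ⟨A, B, E', F, M, hM1, hpMne, hstar⟩ :=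
    exists_trace_identity_of_algebraic q₂ D W hSan hLan hS2 hE0 hL hH0 hH
  have hMne : (M : ℂ) ≠ 0 := by exact_mod_cast (show M ≠ 0 by omega)
  -- the functions `p_M = A + B S`, `p_M⁻ = A - B S`, `p_{M-1} = E' + F S`
  set pM : ℂ → ℂ := fun z => A.eval z + B.eval z * S z with hpM
  set pMm : ℂ → ℂ := fun z => A.eval z - B.eval z * S z with hpMm
  set pM1 : ℂ → ℂ := fun z => E'.eval z + F.eval z * S z with hpM1
  have hpMan : AnalyticAt ℂ pM z₀ :=
    (analyticAt_polynomial_eval A z₀).add ((analyticAt_polynomial_eval B z₀).mul hSan)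
  have hpMman : AnalyticAt ℂ pMm z₀ :=
    (analyticAt_polynomial_eval A z₀).sub ((analyticAt_polynomial_eval B z₀).mul hSan)
  -- `A² - B²D ≠ 0` as a polynomial, and `p_M p_M⁻ ≢ 0`
  have hprod : ∀ z, S z ^ 2 = D.eval z → pM z * pMm z = (A ^ 2 - B ^ 2 * D).eval z := by
    intro z hz
    simp only [hpM, hpMm, eval_sub, eval_mul, eval_pow, ← hz]
    ring
  have hpMm_ne : ¬ pMm =ᶠ[𝓝 z₀] 0 := by
    intro h0
    by_cases hB : B = 0
    · apply hpMne
      filter_upwards [h0] with z hz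
      simp only [hpMm, hB, eval_zero, zero_mul, sub_zero, Pi.zero_apply] at hz
      simp [hpM, hB, hz]
    · -- `S = A/B` near `z₀`, so `D B² = A²`
      have hid : ∀ᶠ z in 𝓝 z₀, (D * B ^ 2).eval z = (A ^ 2).eval z := by
        filter_upwards [h0, hS2] with z hz hSz
        simp only [hpMm, Pi.zero_apply, sub_eq_zero] at hz
        rw [eval_mul, eval_pow, eval_pow, hz, mul_pow, hSz]; ring
      exact sq_mul_ne_sq_of_odd_rootMultiplicity hDodd hB (Polynomial.eq_of_eventually_eval_eq hid)
  have hV₀ : A ^ 2 - B ^ 2 * D ≠ 0 := by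
    intro h0
    have h1 : AGerm.mk z₀ hpMan * AGerm.mk z₀ hpMman = 0 := by
      rw [← AGerm.mk_mul, AGerm.mk_eq_zero_iff]
      filter_upwards [hS2] with z hz
      rw [Pi.mul_apply, hprod z hz, h0, eval_zero, Pi.zero_apply]
    rcases mul_eq_zero.1 h1 with h2 | h2
    · exact hpMne ((AGerm.mk_eq_zero_iff _).1 h2)
    · exact hpMm_ne ((AGerm.mk_eq_zero_iff _).1 h2)
  -- the good neighbourhood of `z₀`
  have hEq : ∀ᶠ z in 𝓝 z₀, (q₂ * D).eval z ≠ 0 :=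
    (analyticAt_polynomial_eval (q₂ * D) z₀).continuousAt.eventually_ne hE0
  have hgood : ∀ᶠ z in 𝓝 z₀, S z ^ 2 = D.eval z ∧ q₂.eval z ≠ 0 ∧ D.eval z ≠ 0 ∧
      HasDerivAt L (W.eval z * S z / (q₂.eval z * D.eval z)) z ∧ AnalyticAt ℂ S z ∧
      (pM z * (2 * q₂.eval z * D.eval z * deriv pM1 z + 2 * W.eval z * M * S z * pM z) -
        2 * q₂.eval z * D.eval z * deriv pM z * pM1 z = 0) := by
    filter_upwards [hS2, hEq, hL, hSan.eventually_analyticAt, hstar] with z h1 h2 h3 h4 h5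
    rw [eval_mul] at h2
    exact ⟨h1, left_ne_zero_of_mul h2, right_ne_zero_of_mul h2, h3, h4, h5⟩
  obtain ⟨r, hr, hball⟩ := Metric.eventually_nhds_iff_ball.1 hgood
  -- a point `z₁` of the ball where `p_M p_M⁻ ≠ 0`
  obtain ⟨z₁, hz₁, hpz₁⟩ : ∃ z₁ ∈ ball z₀ r, pM z₁ * pMm z₁ ≠ 0 := by
    by_contra hnone
    push Not at hnone
    have h1 : AGerm.mk z₀ hpMan * AGerm.mk z₀ hpMman = 0 := by
      rw [← AGerm.mk_mul, AGerm.mk_eq_zero_iff]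
      filter_upwards [Metric.ball_mem_nhds z₀ hr] with z hz using hnone z hz
    rcases mul_eq_zero.1 h1 with h2 | h2
    · exact hpMne ((AGerm.mk_eq_zero_iff _).1 h2)
    · exact hpMm_ne ((AGerm.mk_eq_zero_iff _).1 h2)
  -- a ball around `z₁` inside the good ball on which `p_M p_M⁻ ≠ 0`
  have hS₁ : AnalyticAt ℂ S z₁ := (hball z₁ hz₁).2.2.2.2.1
  have hpMc : ContinuousAt (fun z => pM z * pMm z) z₁ :=
    (((analyticAt_polynomial_eval A z₁).add ((analyticAt_polynomial_eval B z₁).mul hS₁)).mul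
      ((analyticAt_polynomial_eval A z₁).sub ((analyticAt_polynomial_eval B z₁).mul hS₁))).continuousAt
  obtain ⟨r₁, hr₁, hball₁⟩ : ∃ r₁ > 0, ∀ z ∈ ball z₁ r₁, z ∈ ball z₀ r ∧ pM z * pMm z ≠ 0 := by
    have h1 : ∀ᶠ z in 𝓝 z₁, z ∈ ball z₀ r := Metric.isOpen_ball.mem_nhds hz₁
    have h2 : ∀ᶠ z in 𝓝 z₁, pM z * pMm z ≠ 0 := hpMc.eventually_ne hpz₁
    obtain ⟨r₁, hr₁, h⟩ := Metric.eventually_nhds_iff_ball.1 (h1.and h2)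
    exact ⟨r₁, hr₁, h⟩
  -- on that ball: `(p_{M-1}/p_M)' = -M L'`, so `L + p_{M-1}/(M p_M)` is constant
  set ψ : ℂ → ℂ := fun z => L z + pM1 z / ((M : ℂ) * pM z) with hψ
  have hψd : ∀ z ∈ ball z₁ r₁, HasDerivAt ψ 0 z := by
    intro z hz
    obtain ⟨hz0, hne⟩ := hball₁ z hz
    obtain ⟨hSz, hq, hd, hLz, hSa, hst⟩ := hball z hz0
    have hpMz : pM z ≠ 0 := left_ne_zero_of_mul hne
    have hpMa : AnalyticAt ℂ pM z :=
      (analyticAt_polynomial_eval A z).add ((analyticAt_polynomial_eval B z).mul hSa)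
    have hpM1a : AnalyticAt ℂ pM1 z :=
      (analyticAt_polynomial_eval E' z).add ((analyticAt_polynomial_eval F z).mul hSa)
    have hquot : HasDerivAt (fun y => pM1 y / ((M : ℂ) * pM y))
        ((deriv pM1 z * ((M : ℂ) * pM z) - pM1 z * ((M : ℂ) * deriv pM z)) / ((M : ℂ) * pM z) ^ 2) z :=
      hpM1a.differentiableAt.hasDerivAt.div (hpMa.differentiableAt.hasDerivAt.const_mul _)
        (mul_ne_zero hMne hpMz)
    refine (hLz.add hquot).congr_deriv ?_
    have hnum : deriv pM1 z * pM z - pM1 z * deriv pM z =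
        -(W.eval z * M * S z * pM z ^ 2) / (q₂.eval z * D.eval z) := by
      rw [eq_div_iff (mul_ne_zero hq hd)]
      linear_combination (1 / 2 : ℂ) * hst
    rw [show deriv pM1 z * ((M : ℂ) * pM z) - pM1 z * ((M : ℂ) * deriv pM z) =
      (M : ℂ) * (deriv pM1 z * pM z - pM1 z * deriv pM z) by ring, hnum]
    field_simp
    ring
  have hLrepr : ∀ z ∈ ball z₁ r₁, L z = ψ z₁ - pM1 z / ((M : ℂ) * pM z) := by
    intro z hz
    have h := eq_of_hasDerivAt_zero_ball hψd hz (mem_ball_self hr₁)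
    rw [hψ] at h
    simp only at h
    linear_combination h
  -- the explicit rational functions: `L = κ + U₁/V₂ + (V₁/V₂) S`
  set κ : ℂ := ψ z₁ with hκ
  set V₂ : ℂ[X] := C (M : ℂ) * (A ^ 2 - B ^ 2 * D) with hV₂
  set V₁ : ℂ[X] := E' * B - F * A with hV₁
  set U₁ : ℂ[X] := F * B * D - E' * A with hU₁
  have hV₂ne : V₂ ≠ 0 := mul_ne_zero (by rwa [Ne, C_eq_zero]) hV₀
  have hV₂z : ∀ z ∈ ball z₁ r₁, V₂.eval z ≠ 0 := by
    intro z hz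
    obtain ⟨hz0, hne⟩ := hball₁ z hz
    rw [hV₂, eval_mul, eval_C, ← hprod z (hball z hz0).1]
    exact mul_ne_zero hMne hne
  have hLV : ∀ z ∈ ball z₁ r₁,
      L z * V₂.eval z = κ * V₂.eval z + U₁.eval z + V₁.eval z * S z := by
    intro z hz
    obtain ⟨hz0, hne⟩ := hball₁ z hz
    have hSz := (hball z hz0).1
    have hpMz : pM z ≠ 0 := left_ne_zero_of_mul hne
    have h1 : L z * V₂.eval z = κ * V₂.eval z - pM1 z * pMm z := by
      rw [hLrepr z hz, hV₂, eval_mul, eval_C, ← hprod z hSz]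
      field_simp
    rw [h1]
    simp only [hpM1, hpMm, hU₁, hV₁, eval_mul, eval_sub]
    linear_combination (F.eval z * B.eval z) * hSz
  -- comparison of derivatives at every point of the ball: `2q₂D·(U₁'V₂ - U₁V₂') = Γ₁·S`
  set Γ₁ : ℂ[X] := 2 * W * V₂ ^ 2 -
    q₂ * (2 * D * (derivative V₁ * V₂ - V₁ * derivative V₂) + derivative D * V₁ * V₂) with hΓ₁
  set Λ : ℂ[X] := 2 * q₂ * D * (derivative U₁ * V₂ - U₁ * derivative V₂) with hΛ
  have hpoint : ∀ z ∈ ball z₁ r₁, Λ.eval z = S z * Γ₁.eval z := by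
    intro z hz
    obtain ⟨hz0, hne⟩ := hball₁ z hz
    obtain ⟨hSz, hq, hd, hLz, hSa, -⟩ := hball z hz0
    have hV₂0 := hV₂z z hz
    have hS0 : S z ≠ 0 := by
      intro h; rw [h, zero_pow two_ne_zero] at hSz; exact hd hSz.symm
    -- `S' = D'/(2S)`
    set S' := deriv S z with hS'
    have h1 : 2 * S z * S' = (derivative D).eval z := by
      have hsq : HasDerivAt (fun y => S y ^ 2) (((2 : ℕ) : ℂ) * S z ^ (2 - 1) * S') z :=
        hSa.differentiableAt.hasDerivAt.pow 2
      have hDd : HasDerivAt (fun y => S y ^ 2) ((derivative D).eval z) z := by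
        refine (Polynomial.hasDerivAt D z).congr_of_eventuallyEq ?_
        filter_upwards [Metric.isOpen_ball.mem_nhds hz] with y hy
        exact (hball y (hball₁ y hy).1).1
      have := hsq.unique hDd
      rw [← this]; push_cast; ring
    -- the derivative of the explicit representation
    set u' : ℂ := ((derivative U₁).eval z * V₂.eval z - U₁.eval z * (derivative V₂).eval z) /
      V₂.eval z ^ 2 with hu'
    set v' : ℂ := ((derivative V₁).eval z * V₂.eval z - V₁.eval z * (derivative V₂).eval z) /
      V₂.eval z ^ 2 with hv'
    set v : ℂ := V₁.eval z / V₂.eval z with hv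
    have hrepr : HasDerivAt (fun y => κ + U₁.eval y / V₂.eval y + V₁.eval y / V₂.eval y * S y)
        (u' + (v' * S z + v * S')) z := by
      have hu : HasDerivAt (fun y => U₁.eval y / V₂.eval y) u' z :=
        (Polynomial.hasDerivAt U₁ z).div (Polynomial.hasDerivAt V₂ z) hV₂0
      have hvd : HasDerivAt (fun y => V₁.eval y / V₂.eval y) v' z :=
        (Polynomial.hasDerivAt V₁ z).div (Polynomial.hasDerivAt V₂ z) hV₂0
      have hS : HasDerivAt S S' z := hSa.differentiableAt.hasDerivAt
      have h := (hu.const_add κ).add (hvd.mul hS)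
      exact h
    have hLd : HasDerivAt L (u' + (v' * S z + v * S')) z := by
      refine hrepr.congr_of_eventuallyEq ?_
      filter_upwards [Metric.isOpen_ball.mem_nhds hz] with y hy
      have hy2 := hV₂z y hy
      have := hLV y hy
      field_simp
      linear_combination this
    have h3 : W.eval z * S z / (q₂.eval z * D.eval z) = u' + v' * S z + v * S' := by
      have := hLz.unique hLd; rw [this]; ring
    have hkey := quadraticLog_key_identity (Q := q₂.eval z) (d := D.eval z) (w := W.eval z)
      (V₁ := V₁.eval z) (V₂ := V₂.eval z) (s := S z) (D₁ := (derivative D).eval z)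
      (Nu := (derivative U₁).eval z * V₂.eval z - U₁.eval z * (derivative V₂).eval z)
      (Nv := (derivative V₁).eval z * V₂.eval z - V₁.eval z * (derivative V₂).eval z)
      (u' := u') (ℓ := W.eval z * S z / (q₂.eval z * D.eval z)) (v' := v') (v := v) (S' := S')
      (by rw [hu']; field_simp) h3 (by field_simp) (by rw [hv']; field_simp) (by rw [hv]; field_simp)
      hSz h1
    rw [hΛ, hΓ₁]
    simp only [eval_mul, eval_sub, eval_add, eval_pow, eval_ofNat]
    linear_combination hkey
  -- `Γ₁ ≠ 0` (orders at the root `a` of `q₂`)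
  have hΓ₁ne : Γ₁ ≠ 0 := by
    intro h0
    have h := reciprocal_ode_identity_ne (V₁ := V₁) (V₂ := V₂) c hq₂ ha hq₁a hV₂ne
    apply h
    rw [← hD, ← hW]
    exact (sub_eq_zero.1 h0)
  -- the polynomial identity `D Γ₁² = Λ²` on the ball, contradiction
  have hid : D * Γ₁ ^ 2 = Λ ^ 2 := by
    refine Polynomial.eq_of_eventually_eval_eq (z₀ := z₁) ?_
    filter_upwards [Metric.ball_mem_nhds z₁ hr₁] with z hz
    have h := hpoint z hz
    have hSz := (hball z (hball₁ z hz).1).1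
    rw [eval_mul, eval_pow, eval_pow, h, mul_pow, hSz]
  exact sq_mul_ne_sq_of_odd_rootMultiplicity hDodd hΓ₁ne hid

end Summit.Schanuel.Schanuel.Theorems
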